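import Literature.Topology.FourManifolds.GradientLikeDynamics
import Literature.Topology.FourManifolds.IntegralCurveBoundary
import HarnessLib

/-!
# Flows of related vector fields: a map intertwining the fields intertwines the flows

Topic `Literature/Topology/FourManifolds` (fact seat
`provefact-Literature.Topology.FourManifolds.IsHandlebody.exists_isBoundaryGluing_sphere`, step F2b of
the Lickorish–Wallace DAG; flow layer of the handle-extension step of the classification of
handlebodies: on a band below the cut level the field of one manifold is the pull-back of the
field of the other, so the comparison map conjugates the two flows there).  Everything here is
**proved**; no named facts.

**Naturality of flows** (Lee, *Introduction to Smooth Manifolds* (2012), Prop. 9.13 /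
Cor. 9.14: "if `F : M → N` is smooth and `X`, `Y` are `F`-related, then `F ∘ θ_t = η_t ∘ F` on
the flow domains"; Milnor 1965 uses it tacitly whenever trajectories are read in Milnor's
coordinates): let `θ`, `θ'` be global flows of the fields `X` on `M` and `Y` on `M'`
(`Literature.Topology.FourManifolds.IsFlowOf`), `g : M → M'` of class `C¹` on an open `U` with
`dg(X) = Y ∘ g` on `U`.  Then for every orbit segment inside `U`,
`g (θ (t, z)) = θ' (t, g z)` (`IsFlowOf.apply_eq_of_mfderiv_eq`): both sides are integral curves
of `Y` with the same initial point (uniqueness of integral curves on manifolds with boundary,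
`Literature.Topology.FourManifolds.isMIntegralCurveOn_Ioo_eqOn_of_contMDiff`).

## References

* J. M. Lee, *Introduction to Smooth Manifolds*, 2nd ed. (2012), Prop. 9.13, Cor. 9.14.
  [LeeSmoothManifolds2013]
* J. Milnor, *Lectures on the h-cobordism theorem* (1965), §3. [MilnorHCobordism1965]
-/

open scoped Manifold ContDiff Topology
open Set Function Filter

noncomputable section

namespace Literature.Topology.FourManifolds

variable {E : Type*} [NormedAddCommGroup E] [NormedSpace ℝ E] {H : Type*} [TopologicalSpace H]
  {I : ModelWithCorners ℝ E H} {M : Type*} [TopologicalSpace M] [ChartedSpace H M]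
  {E' : Type*} [NormedAddCommGroup E'] [NormedSpace ℝ E'] {H' : Type*} [TopologicalSpace H']
  {I' : ModelWithCorners ℝ E' H'} {M' : Type*} [TopologicalSpace M'] [ChartedSpace H' M']
  {X : Π x : M, TangentSpace I x} {θ : ℝ × M → M}
  {Y : Π y : M', TangentSpace I' y} {θ' : ℝ × M' → M'}

/-- **The image of an orbit under a map intertwining the fields is an integral curve**: if
`dg(X) = Y ∘ g` on the open `U` (`g` of class `C¹` there), then `t ↦ g (θ (t, z))` is an integral
curve of `Y` on every set of times during which the orbit stays in `U`.
[cite: LeeSmoothManifolds2013, Prop. 9.13] -/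
theorem IsFlowOf.isMIntegralCurveOn_comp (h : IsFlowOf I X θ) {U : Set M} (hU : IsOpen U)
    {g : M → M'} (hg : ContMDiffOn I I' 1 g U)
    (hrel : ∀ x ∈ U, mfderiv I I' g x (X x) = Y (g x)) {z : M} {s : Set ℝ}
    (hmem : ∀ t ∈ s, θ (t, z) ∈ U) :
    IsMIntegralCurveOn (fun t => g (θ (t, z))) Y s := by
  intro t ht
  apply HasMFDerivAt.hasMFDerivWithinAt
  have hγ : HasMFDerivAt 𝓘(ℝ, ℝ) I (fun t => θ (t, z)) t
      ((1 : ℝ →L[ℝ] ℝ).smulRight (X (θ (t, z)))) := h.isMIntegralCurve z t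
  have hgd : HasMFDerivAt I I' g (θ (t, z)) (mfderiv I I' g (θ (t, z))) :=
    ((hg.contMDiffAt (hU.mem_nhds (hmem t ht))).mdifferentiableAt one_ne_zero).hasMFDerivAt
  refine (hgd.comp t hγ).congr_mfderiv ?_
  apply ContinuousLinearMap.ext_ring
  show (mfderiv I I' g (θ (t, z))) (((1 : ℝ →L[ℝ] ℝ) (1 : ℝ)) • X (θ (t, z))) =
    ((1 : ℝ →L[ℝ] ℝ) (1 : ℝ)) • Y (g (θ (t, z)))
  rw [map_smul, hrel _ (hmem t ht)]

variable [IsManifold I' 1 M'] [T2Space M']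

/-- **Naturality of flows** (Lee 2012, Prop. 9.13 / Cor. 9.14): with `dg(X) = Y ∘ g` on the open
`U`, `g (θ (t, z)) = θ' (t, g z)` for all `t` in an open interval about `0` during which the
orbit of `z` stays in `U`. [cite: LeeSmoothManifolds2013, Prop. 9.13 and Cor. 9.14] -/
theorem IsFlowOf.apply_eq_of_mfderiv_eq (h : IsFlowOf I X θ) (h' : IsFlowOf I' Y θ')
    (hY : ContMDiff I' I'.tangent 1 fun y => (⟨y, Y y⟩ : TangentBundle I' M'))
    {U : Set M} (hU : IsOpen U) {g : M → M'} (hg : ContMDiffOn I I' 1 g U)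
    (hrel : ∀ x ∈ U, mfderiv I I' g x (X x) = Y (g x)) {z : M} {t₁ t₂ : ℝ}
    (h0 : (0 : ℝ) ∈ Ioo t₁ t₂) (hmem : ∀ t ∈ Ioo t₁ t₂, θ (t, z) ∈ U) {t : ℝ} (ht : t ∈ Ioo t₁ t₂) :
    g (θ (t, z)) = θ' (t, g z) := by
  have hγ := h.isMIntegralCurveOn_comp hU hg hrel hmem
  have hγ' : IsMIntegralCurveOn (fun t => θ' (t, g z)) Y (Ioo t₁ t₂) :=
    (h'.isMIntegralCurve (g z)).isMIntegralCurveOn _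
  have heq := isMIntegralCurveOn_Ioo_eqOn_of_contMDiff h0 hY hγ hγ' (by
    show g (θ (0, z)) = θ' (0, g z)
    rw [h.map_zero, h'.map_zero])
  exact heq ht

/-- Naturality of flows on a closed time interval `[0, T]` inside which the orbit stays in `U`
(by openness the orbit stays in `U` slightly longer). [cite: LeeSmoothManifolds2013, Prop. 9.13 and Cor. 9.14] -/
theorem IsFlowOf.apply_eq_of_mfderiv_eq_of_Icc (h : IsFlowOf I X θ) (h' : IsFlowOf I' Y θ')
    (hY : ContMDiff I' I'.tangent 1 fun y => (⟨y, Y y⟩ : TangentBundle I' M'))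
    {U : Set M} (hU : IsOpen U) {g : M → M'} (hg : ContMDiffOn I I' 1 g U)
    (hrel : ∀ x ∈ U, mfderiv I I' g x (X x) = Y (g x)) {z : M} {T₁ T₂ : ℝ} (hT₁ : T₁ ≤ 0)
    (hT₂ : 0 ≤ T₂) (hmem : ∀ t ∈ Icc T₁ T₂, θ (t, z) ∈ U) {t : ℝ} (ht : t ∈ Icc T₁ T₂) :
    g (θ (t, z)) = θ' (t, g z) := by
  -- the set of times at which the orbit is in `U` is open and contains `[T₁, T₂]`
  have hopen : IsOpen {t : ℝ | θ (t, z) ∈ U} := hU.preimage (h.continuous_orbit z)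
  obtain ⟨δ, hδ, hsub⟩ : ∃ δ > 0, ∀ s, T₁ - δ < s → s < T₂ + δ → θ (s, z) ∈ U := by
    have hK : IsCompact (Icc T₁ T₂) := isCompact_Icc
    obtain ⟨δ, hδ, hthick⟩ := hK.exists_thickening_subset_open hopen (fun s hs => hmem s hs)
    refine ⟨δ, hδ, fun s hs1 hs2 => hthick ?_⟩
    rw [Metric.mem_thickening_iff]
    rcases le_or_gt s T₁ with hs | hs
    · exact ⟨T₁, left_mem_Icc.2 (hT₁.trans hT₂), by rw [Real.dist_eq, abs_of_nonpos (by linarith)]; linarith⟩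
    · rcases le_or_gt s T₂ with hs' | hs'
      · exact ⟨s, ⟨hs.le, hs'⟩, by rw [dist_self]; exact hδ⟩
      · exact ⟨T₂, right_mem_Icc.2 (hT₁.trans hT₂), by rw [Real.dist_eq, abs_of_pos (by linarith)]; linarith⟩
  exact h.apply_eq_of_mfderiv_eq h' hY hU hg hrel (z := z) (t₁ := T₁ - δ) (t₂ := T₂ + δ)
    ⟨by linarith, by linarith⟩ (fun s hs => hsub s hs.1 hs.2) ⟨by linarith [ht.1], by linarith [ht.2]⟩

end Literature.Topology.FourManifolds
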